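import Mathlib.LinearAlgebra.FiniteDimensional.Lemmas
import Mathlib.LinearAlgebra.Dimension.StrongRankCondition
import Mathlib.Tactic.Linarith
import Mathlib.Tactic.Ring
import Literature.AlgebraicGeometry.HodgeTheory.SemiregularityWeakCriterion
import HarnessLib

/-!
# The (0,1) cell of the ι-window, EXCLUSION side, X: Markman's diagram (8.3.3) from refereed print, and the curve clause [†]

Family `hodge`, b2b cell `hweil` (helper of item stmt-HodgeConjecture-2524). Report
`run/shared/lean/b2b/hodge-weil/b2b-hweil-pv1-g22/H2-ZERO-ONE-10.md` (prover 1 gen 22). Companion to `WeilTypeLadderH2QuotTangent.lean` (gen 21) and to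
`Literature/AlgebraicGeometry/HodgeTheory/SemiregularityWeakCriterion.lean` (whose abstract modules `H = HT²(M)`, `E = Ext²(E,E)`, `Ω = ⊕ H^{q+2}(Ω^q)` and
maps `ev = ob_E`, `σ`, `c = ⌟ch(E)` are reused here). HONEST FRAMING: a literature certification plus structure results about one cell of the ladder's H2 test
on the exclusion side; no case of the Hodge conjecture is proved; nothing here is a rung; no statement of [Markman 2025] is used.

## Section `SR833` — the commutativity (8.3.3) is refereed print; its uses are robust to normalisations

[Mar25, §8.3] asserts the commutative triangle `σ ∘ ob_E = ⌟ch(E)` on `HT²(M) = H²(𝒪) ⊕ H¹(T) ⊕ H⁰(∧²T)` "by [buchweitz-flenner-HH]", and the ladder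
cell had booked every consequence '[mod (8.3.3)]' because the `∧²T`-summand was held only as Markman's (unrefereed) sketch. The report §1 shows the
triangle is refereed print for EVERY perfect complex on EVERY smooth projective variety over `ℂ`:
* R.-O. Buchweitz, H. Flenner, *The global decomposition theorem for Hochschild (co-)homology of singular spaces via the Atiyah–Chern character*, Adv.
  Math. 217 (2008) [`BuchweitzFlenner2008HH`, held doi-10-1016-j-aim-2007-06-013], **Proposition 6.4.4** (p.32, verbatim): "Let `X → Y` be a morphism
  of complex spaces. If `F` is a perfect complex on `X` and `N` is an `𝒪_X`–module then the diagram [`Ext^•_X(S^k,N) →(⌟(−1)^k At^k_F/k!) Ext^•_X(F,F⊗N)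
  →(σ^N_F) H^•(X,N⊗S)` versus `⌟ch(F)`] commutes", whose proof establishes "`Tr(At^n_F/n! · ξ ⌟ At^k_F/k!) = ξ ⌟ Tr(At^{k+n}_F/(k+n)!)`" for all `k, n`
  (for `k = 2` this is letter for letter Markman's displayed form `(k+2)(k+1)Tr(⟨ξ,at²⟩at^k) = 2⟨ξ,Tr at^{k+2}⟩`); here `S = S(L_{X/Y}[1])`, which for
  `X` smooth over a point is `⊕ Λ^pΩ_X[p]`, so `Ext²(S^k, 𝒪_X) = H^{2−k}(X, Λ^kT_X)`, `k = 0,1,2` — the three summands of `HT²(X)`;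
* S. Huang, *A note on a question of Markman*, J. Pure Appl. Algebra 225 (2021) [`Huang2021Markman`, held arxiv-2011.10207], **Theorem A**: the
  composite `HT^*(X) →(I^{HKR}) HH^*(X) → Ext^*(F,F)` "is commutative" with `(−) ⌟ exp(at_F)`, `exp(at_F) = Σ (at_F)^k/k!` — i.e. Markman's `ob_E =
  ev_E ∘ HKR` IS Toda's contraction class `u·exp a(E)` of [`Toda2009DeformationsFM`, Prop. 6.1].
With Markman's sign convention `at = −At` ([Mar25] §7.1 footnote: "in [buchweitz-flenner] `ch(E) = Tr(−at_E)`") B–F's `(σ^{BF}, ch^{BF}, (−1)^kAt^k/k!)`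
become `(σ, ch, at^k/k!)`, so Prop. 6.4.4 with `N = 𝒪_X`, `r = 2`, `k = 0,1,2` is exactly `σ ∘ ob_E = ⌟ch(E)` summand by summand. The theorems below
record the (trivial) linear algebra that makes the cell's three uses of (8.3.3) independent even of the per-summand normalisation constants: with any
linear automorphism `τ` of `H` (rescaling the three summands), `σ ∘ ev = c ∘ τ` still gives `ker ev ≤ τ⁻¹(ker c)`, the twisted weak criterion, the
kernel equality `ker ev = ker(σ∘ev)` from the (0,1) rank count (`ev` onto a space of dimension `rank(σ∘ev)`), and the (LP) directions.

## Section `H2CurveClause` — the (8.3.3)-free structure theorems K / W / W9 / CT of the report §3 (integer / rational skeletons)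

Dictionary (report §0): `S = S_a` a normal theta c.i. on the very general ppav fourfold, `F ⊂ F′ ⊂ F″ ⊂ E` with `F′/F = T₀` (length `t`), `F″/F′ = T₁` the
curve part of class `nγ` (`γ = θ³/6`, `γ·θ = 4`), `E/F″ = G ⊂ N` of colength `ℓ`, `χ₁ = χ(T_{≤1}) = t + χ(T₁)`, `c_K, c_N` the Riemann–Roch defects.
THEOREM K: comparing `χ(F″(mΘ)) = χ(F(mΘ)) + χ(T_{≤1}(mΘ)) = 2m⁴ − 12m² + 8m + χ₁ + 4nm` with `2χ(𝓘_S(m)) + χ(S, K(m))` gives `N·θ_S = 16 − 4n`,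
`N² = 2χ₁ + 8n − 4 − 2c_K`, and with `ℓ = N² + c_K + c_N`, `c_K = c_N` (THEOREM 1): `ℓ = 2χ₁ + 8n − 4`, `t = ℓ/2 + 2 − 4n − χ(T₁)` (`cc_bookkeeping`,
`cc_torsion_general`). THEOREM W: curves on `X` have `Θ`-degree a positive multiple of 8 (hard Lefschetz + `NS = ℤθ` + Matsusaka–Ran), `N·θ_S = D₁·Θ`
for the effective `D₁ = div s₁`, so `n ∈ {2,4}` (`cc_n_sieve`); for `n = 2`, `ℓ ∈ {0,2}` when `c_N ≤ 0` (`cc_hodge_index_n2`). LEMMA W9 [Welters 1987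
§2, `Welters1987TwiceMinimal`]: outside three loci of dimension ≤ 9 in `𝒜₄` (`cc_welters_moduli`) an integral class-`2γ` curve has normalization of genus
`9 − δ/2`, `δ ∈ {0,2,4}`, and ≥ `δ/2` singular points, so `p_a ≥ 9` (`cc_welters_genus`). THEOREM CT: if the curve part is an `𝒪_S`-module (no
whisker), `T₁ = K|_B/torsion ↪ E|_B`, so `χ(T₁) ≤ χ(L|_B) = 1 − p_a(B)` (`cc_T1_chi_le`) and `t = ℓ/2 − 6 − χ(T₁) ≥ 2` (`cc_torsion_forcing`): torsion is
forced, and then (QT) + T³ at a fixed point off the curve give `e₁^ι ≥ 3` (`cc_e1_offB`), at a fixed point on the curve with a type-1 germ the mapping cone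
gives `β₂ ≤ 2` and `tan ≥ 3` (`cc_beta2_cone`).
-/

-- mandated namespace `Summit.HodgeConjecture.HodgeConjecture.…` (Problem = Summit) trips `linter.dupNamespace`; the lakefile disables it
-- tree-wide (weak option), restated here so stand-alone elaboration is warning-free too.
set_option linter.dupNamespace false

namespace Summit.HodgeConjecture.HodgeConjecture.WeilTypeLadder

section SR833

open Module

variable {R : Type*} [CommRing R]
variable {H E Ω : Type*} [AddCommGroup H] [Module R H] [AddCommGroup E] [Module R E]
  [AddCommGroup Ω] [Module R Ω]

/-- **(8.3.3) summand by summand.** If the triangle `σ (ev x) = c x` holds on three submodules `S₀, S₁, S₂` of `H` that span `H` (for `HT²(X)`: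
`H²(𝒪) ⊔ H¹(T) ⊔ H⁰(∧²T) = ⊤`), it holds on `H`. The three summand identities are Buchweitz–Flenner 2008 Prop. 6.4.4 for `k = 0, 1, 2`
(`k = 1` = Buchweitz–Flenner 2003 Cor. 4.3). [cite: BuchweitzFlenner2008HH, Prop. 6.4.4; Markman2025SecantWeil, §8.3 (8.3.3)] -/
theorem sr833_comm_of_summands (ev : H →ₗ[R] E) (σ : E →ₗ[R] Ω) (c : H →ₗ[R] Ω)
    (S₀ S₁ S₂ : Submodule R H) (hspan : S₀ ⊔ S₁ ⊔ S₂ = ⊤)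
    (h₀ : ∀ x ∈ S₀, σ (ev x) = c x) (h₁ : ∀ x ∈ S₁, σ (ev x) = c x) (h₂ : ∀ x ∈ S₂, σ (ev x) = c x) :
    σ ∘ₗ ev = c := by
  have key : S₀ ⊔ S₁ ⊔ S₂ ≤ LinearMap.ker (σ ∘ₗ ev - c) := by
    refine sup_le (sup_le ?_ ?_) ?_
    · intro x hx
      rw [LinearMap.mem_ker, LinearMap.sub_apply, LinearMap.comp_apply, h₀ x hx, sub_self]
    · intro x hx
      rw [LinearMap.mem_ker, LinearMap.sub_apply, LinearMap.comp_apply, h₁ x hx, sub_self]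
    · intro x hx
      rw [LinearMap.mem_ker, LinearMap.sub_apply, LinearMap.comp_apply, h₂ x hx, sub_self]
  rw [hspan, top_le_iff, LinearMap.ker_eq_top] at key
  exact sub_eq_zero.mp key

/-- **Twisted triangle ⟹ `ker ev ≤ τ⁻¹(ker c)`.** If the normalisations of the three summands differ by constants (`σ ∘ ev = c ∘ τ` for a linear
`τ`, e.g. `τ = diag(λ₀,λ₁,λ₂)`), every direction along which `E` lifts to first order keeps `ch(E)` Hodge after rescaling by `τ` (Huang 2021 Thm B on
an abelian variety is the case `τ = id`). [cite: BuchweitzFlenner2008HH, Prop. 6.4.4; Huang2021Markman, Thm. B] -/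
theorem sr833_ker_le_comap (ev : H →ₗ[R] E) (σ : E →ₗ[R] Ω) (c : H →ₗ[R] Ω) (τ : H →ₗ[R] H)
    (hcomm : σ ∘ₗ ev = c ∘ₗ τ) : LinearMap.ker ev ≤ (LinearMap.ker c).comap τ := by
  intro x hx
  rw [LinearMap.mem_ker] at hx
  rw [Submodule.mem_comap, LinearMap.mem_ker, ← LinearMap.comp_apply, ← hcomm, LinearMap.comp_apply, hx, map_zero]

/-- **Twisted weak criterion.** Given `σ ∘ ev = c ∘ τ`, Markman's weak criterion (`σ` injective on `range ev`) is equivalent to `τ⁻¹(ker c) ≤ ker ev`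
(the untwisted statement is `Literature.…weakCriterion_iff_ker_contract_le_ker_ev`). [cite: Markman2025SecantWeil, Remark 8.3.5] -/
theorem sr833_weak_twist (ev : H →ₗ[R] E) (σ : E →ₗ[R] Ω) (c : H →ₗ[R] Ω) (τ : H →ₗ[R] H)
    (hcomm : σ ∘ₗ ev = c ∘ₗ τ) :
    (∀ η : H, σ (ev η) = 0 → ev η = 0) ↔ (LinearMap.ker c).comap τ ≤ LinearMap.ker ev := by
  have h := Literature.AlgebraicGeometry.HodgeTheory.weakCriterion_iff_ker_contract_le_ker_ev ev σ (c ∘ₗ τ) hcomm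
  rw [LinearMap.ker_comp] at h
  exact h

/-- **(LP)'s step under a twist.** If `ker ev = τ⁻¹(ker c)` for a linear automorphism `τ` of `H` then every `η` annihilating `ch` (`c η = 0`, e.g. a
spinorial direction `η_P`) yields the unobstructed direction `τ⁻¹ η` (`ev (τ.symm η) = 0`); since `τ` only rescales the bivector `P`, the Zariski-open set
of Poisson structures along which `E|_U` lifts (Toda 2009 Prop. 6.1) is unchanged. [cite: Toda2009DeformationsFM, Prop. 6.1] -/
theorem sr833_LP_direction (ev : H →ₗ[R] E) (c : H →ₗ[R] Ω) (τ : H ≃ₗ[R] H)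
    (hker : LinearMap.ker ev = (LinearMap.ker c).comap (τ : H →ₗ[R] H)) {η : H} (hη : c η = 0) :
    ev (τ.symm η) = 0 := by
  have hmem : τ.symm η ∈ LinearMap.ker ev := by
    rw [hker, Submodule.mem_comap, LinearMap.mem_ker, LinearEquiv.coe_coe, LinearEquiv.apply_symm_apply]
    exact hη
  exact LinearMap.mem_ker.mp hmem

end SR833

section SR833rank

open Module

variable {K : Type*} [DivisionRing K]
variable {H E Ω : Type*} [AddCommGroup H] [Module K H] [AddCommGroup E] [Module K E]
  [AddCommGroup Ω] [Module K Ω]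

/-- **C74 (ii)'s rank count.** Let `ev : H → E′` (for a (0,1) object: `E′ = Ext²(F,F)^ι`, `dim E′ = 12`) and suppose the composite `σ ∘ ev` has rank
at least `dim E′` (by (8.3.3) its rank is `rank(⌟ch(F)∘τ) = rank ⌟ch(F) = 28 − 16 = 12`, Prop D). Then `ev` is SURJECTIVE onto `E′` and
`ker ev = ker(σ ∘ ev)` (`= τ⁻¹ ann(ch F)`): the hypothesis of (LP). Proved: `range(σ∘ev) = σ(range ev)` has dimension ≤ `dim range ev ≤ dim E′`, so all
three are equal; equality of the first two makes `σ` injective on `range ev`. [cite: Markman2025SecantWeil, Lemma 8.3.4] -/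
theorem sr833_ker_eq_of_finrank [FiniteDimensional K E] (ev : H →ₗ[K] E) (σ : E →ₗ[K] Ω)
    (h : finrank K E ≤ finrank K (LinearMap.range (σ ∘ₗ ev))) :
    Function.Surjective ev ∧ LinearMap.ker ev = LinearMap.ker (σ ∘ₗ ev) := by
  have hcomp : LinearMap.range (σ ∘ₗ ev) = (LinearMap.range ev).map σ := LinearMap.range_comp ev σ
  -- the restriction of σ to range ev
  set V : Submodule K E := LinearMap.range ev with hV
  set σV : V →ₗ[K] Ω := σ ∘ₗ V.subtype with hσV
  have hrangeV : LinearMap.range σV = V.map σ := by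
    rw [hσV, LinearMap.range_comp, Submodule.range_subtype]
  have hrn : finrank K (LinearMap.range σV) + finrank K (LinearMap.ker σV) = finrank K V :=
    LinearMap.finrank_range_add_finrank_ker σV
  have hVle : finrank K V ≤ finrank K E := Submodule.finrank_le V
  have h1 : finrank K E ≤ finrank K (LinearMap.range σV) := by rw [hrangeV, ← hcomp]; exact h
  have hkerV : finrank K (LinearMap.ker σV) = 0 := by omega
  have hVE : finrank K V = finrank K E := by omega
  have htop : V = ⊤ := Submodule.eq_top_of_finrank_eq hVE
  refine ⟨?_, ?_⟩
  · rw [← LinearMap.range_eq_top, ← hV, htop]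
  · apply le_antisymm
    · intro x hx
      rw [LinearMap.mem_ker] at hx
      rw [LinearMap.mem_ker, LinearMap.comp_apply, hx, map_zero]
    · intro x hx
      rw [LinearMap.mem_ker, LinearMap.comp_apply] at hx
      have hkerbot : LinearMap.ker σV = ⊥ := Submodule.finrank_eq_zero.mp hkerV
      have hxV : ev x ∈ V := LinearMap.mem_range_self ev x
      have : (⟨ev x, hxV⟩ : V) ∈ LinearMap.ker σV := by
        rw [LinearMap.mem_ker, hσV, LinearMap.comp_apply, Submodule.subtype_apply]
        exact hx
      rw [hkerbot, Submodule.mem_bot] at this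
      rw [LinearMap.mem_ker]
      exact congrArg Subtype.val this

end SR833rank

section H2CurveClause

/-- **THEOREM K (two-section bookkeeping with a curve part; report §3.1).** On a normal `S_a` (`χ(𝒪_S(m)) = 12m² − 24m + 14`, `K_S = 2θ_S`,
`θ_S² = 24`), with `ch(F) = (2,0,−θ²,2γ,0)` and curve part of class `nγ` (`γ·θ = 4`): `χ(F″(m)) = 2m⁴ − 12m² + (8 + 4n)m + χ₁` equals
`2χ(𝓘_S(m)) + χ(S,K(m))` with `χ(S,K(m)) = 14 + ½(N² + 2mK·θ + 24m²) − K·θ − 24m… + c_K`, `K·θ = −N·θ`. The `m`-coefficients give `hlin`, the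
constants give `hconst`; `0 → K → E_S → G → 0` gives `ℓ = N² + c_K + c_N`; THEOREM 1 gives `c_K = c_N`. Conclusion: `N·θ_S = 16 − 4n`,
`N² = 2χ₁ + 8n − 4 − 2c_K`, `ℓ = 2χ₁ + 8n − 4`. [new] -/
theorem cc_bookkeeping (n χ₁ Nθ N2 cK cN ℓ : ℚ)
    (hlin : 48 + (-Nθ - 24) = 8 + 4 * n) (hconst : -28 + (14 + N2 / 2 + Nθ + cK) = χ₁)
    (hℓ : ℓ = N2 + cK + cN) (hT1 : cK = cN) :
    Nθ = 16 - 4 * n ∧ N2 = 2 * χ₁ + 8 * n - 4 - 2 * cK ∧ ℓ = 2 * χ₁ + 8 * n - 4 := by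
  refine ⟨by linarith, by linarith, by linarith⟩

/-- **THEOREM K, the torsion length.** With `χ₁ = t + χ(T₁)` and `ℓ = 2χ₁ + 8n − 4`: `t = ℓ/2 + 2 − 4n − χ(T₁)` (`n = 0`: THEOREM 1's `ℓ = 2t − 4`;
`n = 2`: `t = ℓ/2 − 6 − χ(T₁)`; `n = 4`: `t = ℓ/2 − 14 − χ(T₁)`). [new] -/
theorem cc_torsion_general (n t χ₁ χT₁ ℓ : ℚ) (hχ : χ₁ = t + χT₁) (hℓ : ℓ = 2 * χ₁ + 8 * n - 4) :
    t = ℓ / 2 + 2 - 4 * n - χT₁ := by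
  linarith

/-- **THEOREM W (a), the n-sieve (report §3.2).** `1 ≤ n` (curve part present), `N·θ_S = 16 − 4n = D₁·Θ` is the `Θ`-degree of the effective divisor
`D₁ = div s₁`, hence `0` (D₁ = 0) or `≥ 8` (every curve on the very general `X` has class `mγ`, `m ≥ 2`: hard Lefschetz + `NS = ℤθ` + Matsusaka–Ran),
and `n ≠ 1` (a class-`γ` support is excluded for the same reason). Hence `n ∈ {2, 4}`. [new] -/
theorem cc_n_sieve (n : ℤ) (h1 : 1 ≤ n) (hdeg : 16 - 4 * n = 0 ∨ 8 ≤ 16 - 4 * n) (hn1 : n ≠ 1) :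
    n = 2 ∨ n = 4 := by
  omega

/-- **THEOREM W (b), `n = 2`: `ℓ ∈ {0,2}` when the defects are non-positive.** Hodge index `24·N² ≤ (N·θ_S)² = 64`, `N² = ℓ − 2c_N`
(THEOREM K + THEOREM 1), `c_N ≤ 0` (e.g. all singular points rational, THEOREM 1.4), `ℓ ≥ 0` even (`ℓ = 2χ₁ + 12`). [new] -/
theorem cc_hodge_index_n2 (N2 cN : ℚ) (ℓ : ℤ) (hHI : 24 * N2 ≤ 64) (hN2 : N2 = (ℓ : ℚ) - 2 * cN)
    (hc : cN ≤ 0) (hℓ0 : 0 ≤ ℓ) (heven : ∃ k : ℤ, ℓ = 2 * k) : ℓ = 0 ∨ ℓ = 2 := by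
  have h3 : (ℓ : ℚ) < 3 := by linarith
  have h3' : ℓ < 3 := by exact_mod_cast h3
  obtain ⟨k, hk⟩ := heven
  omega

/-- **LEMMA W9, the three excluded Welters loci have dimension ≤ 9 < 10 = dim 𝒜₄** (report §3.3): Case I / II− are indexed by genus-4 curves
(`dim 𝓜₄ = 9`), Case II+ with `δ` branch points by `(N₀, branch divisor)` with `g(N₀) = 5 − δ/2`: `3(5 − δ/2) − 3 + δ = 12 − δ/2 ≤ 9` for `δ = 6`,
and `dim 𝓜_{1,8}/Aut = 8`, `dim 𝓜_{0,10} = 7` for `δ = 8, 10`. [cite: Welters1987TwiceMinimal, §2 (2.4)–(2.17)] -/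
theorem cc_welters_moduli :
    (9 : ℤ) < 10 ∧ (3 * (5 - 3) - 3 + 6 : ℤ) ≤ 9 ∧ (1 + 8 - 1 : ℤ) ≤ 9 ∧ (10 - 3 : ℤ) ≤ 9 ∧
      ∀ δ : ℤ, 6 ≤ δ → 12 - δ / 2 ≤ 9 := by
  refine ⟨by norm_num, by norm_num, by norm_num, by norm_num, ?_⟩
  intro δ hδ
  omega

/-- **LEMMA W9, the genus bound** (report §3.3): in Welters' Case II+ on a fourfold (`g = 4`) the normalization `N` of an integral class-`2γ` curve `C`
has genus `gN` with `2gN = 2(2g+1) − δ` [Welters (2.7)], `δ ∈ {0,2,4}` outside the loci of `cc_welters_moduli`, and `C` has at least `s ≥ δ/2` singular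
points (the `l`-fixed points are identified in pairs: `δ = 2`: `P₁ − P₂ ∈ ker(1 − l) = π^*JN₀ ⊂ ker u`; `δ = 4`: `K = {0,[P_i − P_j]}` of order 2),
each contributing ≥ 1 to `p_a(C) − g(N)`. Hence `p_a(C) ≥ 9` (and `g(N) ∈ {7,8,9}`). [cite: Welters1987TwiceMinimal, §2 (2.6), (2.7), (2.10), (2.11)] -/
theorem cc_welters_genus (g gN δ s pa : ℤ) (hg : g = 4) (hgN : 2 * gN = 2 * (2 * g + 1) - δ)
    (hδ : δ = 0 ∨ δ = 2 ∨ δ = 4) (hs : δ ≤ 2 * s) (hpa : gN + s ≤ pa) :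
    9 ≤ pa ∧ 7 ≤ gN ∧ gN ≤ 9 := by
  omega

/-- **THEOREM CT, step (3)** (report §3.4): in case (O) the curve part `T₁ = K|_B/torsion` injects into `E|_B`, hence (composing with a projection)
into a degree-0 line bundle `L|_B` on the integral curve `B` with finite cokernel: `χ(T₁) ≤ χ(L|_B) = deg L|_B + χ(𝒪_B) = 0 + (1 − p_a(B))`. [new] -/
theorem cc_T1_chi_le (χT₁ χL degL χOB pa : ℤ) (hinj : χT₁ ≤ χL) (hRR : χL = degL + χOB) (hdeg : degL = 0)
    (hOB : χOB = 1 - pa) : χT₁ ≤ 1 - pa := by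
  omega

/-- **THEOREM CT (torsion forced by an 𝒪_S-module curve part; report §3.4).** `n = 2`: `t = ℓ/2 − 6 − χ(T₁)` (THEOREM K), `ℓ ≥ 0`,
`χ(T₁) ≤ 1 − p_a(B)` (`cc_T1_chi_le`), `p_a(B) ≥ 9` (LEMMA W9). Hence `t ≥ 2`: the 0-dimensional torsion `T₀` is non-zero — route (α) of
H2-ZERO-ONE-9 §4 in the non-whisker case. [new] -/
theorem cc_torsion_forcing (t ℓ χT₁ pa : ℤ) (ht : 2 * t = ℓ - 12 - 2 * χT₁) (hℓ : 0 ≤ ℓ) (hχ : χT₁ ≤ 1 - pa)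
    (hpa : 9 ≤ pa) : 2 ≤ t := by
  omega

/-- **COROLLARY CT′ (ii)** (report §3.5): torsion at a fixed point `x` OFF the curve: `F′_x` is one of the six hulls, `tan_x ≥ 3` (T³, gen 21), and
(QT) with `Hom_X(F,F′)^ι = k` for `n = 2` gives `e₁^ι ≥ tan_x − (hom − 1) ≥ 3`; in particular `e₁^ι ≠ 1`. [new] -/
theorem cc_e1_offB (e1 tan hom : ℤ) (hQT : tan ≤ e1 + (hom - 1)) (hhom : hom = 1) (hT3 : 3 ≤ tan) :
    2 ≤ e1 ∧ e1 ≠ 1 := by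
  omega

/-- **COROLLARY CT′ (iii), the mapping cone at a fixed point ON the curve** (report §3.5): `F′_x = ker(F″_x ↠ T₁,x)` has `β₂(F′_x) ≤ β₂(F″_x) + γ₃(T₁,x)`
(cone of the resolutions); for a hull with `β₂ ≤ 1` and a curve-part germ of Cohen–Macaulay type `γ₃ = 1` this is ≤ 2, and then T²′ (balanced case:
`4n − 2h² + e² ≤ 2·tan`, `h² ≤ n·β₂`, `e² ≥ 6`, gen 21 `qt_master`) gives `tan ≥ 3`. [new] -/
theorem cc_beta2_cone (n tan b2M g3 b2M' h2 e2 : ℤ) (hcone : b2M' ≤ b2M + g3) (hb : b2M ≤ 1) (hg : g3 = 1)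
    (hmaster : 4 * n - 2 * h2 + e2 ≤ 2 * tan) (hh2 : h2 ≤ n * b2M') (hn : 1 ≤ n) (he2 : 6 ≤ e2) :
    b2M' ≤ 2 ∧ 3 ≤ tan := by
  have hb2 : b2M' ≤ 2 := by omega
  have hmul : n * b2M' ≤ n * 2 := mul_le_mul_of_nonneg_left hb2 (by omega)
  refine ⟨hb2, ?_⟩
  omega

end H2CurveClause

end Summit.HodgeConjecture.HodgeConjecture.WeilTypeLadder
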